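import Literature.NumberTheory.EllipticCurves.CuspFormLFunctionCriticalNonvanishingProofs
import Literature.NumberTheory.EllipticCurves.BSDWave0ModularityProofs
import HarnessLib

/-!
# Non-vanishing of newform `L`-functions on Rankin's half-plane `re s > (k+1)/2` — UNCONDITIONAL
# (no Deligne bound): `L(f, s) ≠ 0` there, `L(f, k − 1) ≠ 0` for `k ≥ 4`, and every NON-CENTRAL
# critical value `Λ(f, n) ≠ 0` (`1 ≤ n ≤ k − 1`, `2n ≠ k`)

Topic `Literature/NumberTheory/EllipticCurves`, namespace
`Literature.NumberTheory.EllipticCurves.ModularForms`. THEOREMS ONLY (no definition, no named fact).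

The tree flags twice that the boundary of Hecke's half-plane «needs Deligne's bound»:
`CuspFormLFunctionCriticalNonvanishingProofs` ("The boundary case `2n + 2 = k` (absolute convergence
at `re s = k/2 + 1`) needs Deligne's bound and is not treated") and
`CuspFormLFunctionDeligneNonvanishingProofs` (everything GRANTED the named fact
`Deligne1974_heckeT_eigenvalue_norm_le`, on `re s > (k+1)/2 + 1/8`). Neither flag is necessary: the
tree ALREADY proves Rankin's mean-square bound — `LSeriesSummable_cuspCoeff_of_lt_re`
(`CuspFormLFunctionProofs`; Rankin 1977, Thm. 4.5.2 (iii)–(iv): Parseval along a horocycle +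
`|f| ≤ C·im^{-k/2}` give `∑_{n ≤ x} |aₙ|² ≪ x^k`, hence `∑ |aₙ| n^{-σ} < ∞` for `σ > (k+1)/2`) —
i.e. ABSOLUTE convergence of `L(f, s)` on the whole of Deligne's half-plane `re s > (k+1)/2`, with no
input beyond the definition of a cusp form. Feeding it to the sieve argument
`HeckeRecursionLSeries.LSeries_ne_zero_of_heckeRecursion` (the Euler product, Diamond–Shurman
Thm. 5.9.2) exactly as `IsNewform0.cuspFormLSeries_ne_zero` does on `re s > k/2 + 1` gives, for a
newform `f ∈ S_k(Γ₀(N))`: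

* `IsNewform0.cuspFormLSeries_ne_zero_of_lt_re` — **`L(f, s) ≠ 0` for `re s > (k+1)/2`**
  (unconditional; supersedes `…_of_deligne` on `re s > (k+1)/2 + 1/8` and Hecke's `re s > k/2 + 1`);
  `IsNewform0.cuspFormLSeries_ne_zero_of_le_re` — in particular on `re s ≥ k/2 + 1`, boundary included;
* `IsNewform0.completedCuspFormL_ne_zero_of_lt_re` — `Λ_N(f, s) = N^{s/2}(2π)^{-s}Γ(s)L(f, s) ≠ 0`
  for `re s > (k+1)/2`, `re s > 0`;
* `IsNewform0.cuspFormLSeries_edge_ne_zero` — **the last critical value `L(f, k − 1) ≠ 0` for every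
  `k ≥ 4`** (e.g. the edge value `L(g, p)` of a weight-`(p+1)` newform at EVERY odd prime `p`,
  including `p = 3`: weight `4`, `s = 3 = k/2 + 1`), and `IsNewform0.cuspFormLSeries_natCast_ne_zero`
  (`L(f, m) ≠ 0` for every integer `m` with `k + 1 < 2m`);
* `IsNewform0.completedLValue_ne_zero_of_lt_two_mul` — `Λ(f, n) = ∫₀^∞ f(it) t^{n-1} dt ≠ 0` for
  `k + 1 < 2n` (right of the centre: `Λ(f, n)` is the Mellin transform at `n`, and Hecke's entire
  function agrees with `L(f, ·)` on Rankin's half-plane, `heckeContinuation_eq_cuspFormLSeries_of_lt_re`);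
* `IsNewform0.completedLValue_ne_zero_of_two_mul_add_two_le` — `Λ(f, n) ≠ 0` for `0 < n`,
  `2n + 2 ≤ k` (left of the centre, the boundary `2n + 2 = k` INCLUDED): Hecke's functional equation
  `Λ(n) = i^k ε(f) Λ(k − n)` for THE entire continuation (`IsNewform0.exists_functional_equation_holds`,
  `subsingleton_completedCuspFormLContinuations`), whose agreement with the raw product is pushed from
  `re s > k/2 + 1` to `re s > (k+1)/2` by `eq_completedCuspFormL_of_mem_continuations_of_lt_re`
  (identity theorem), and `re (k − n) = k − n ≥ k/2 + 1 > (k+1)/2`;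
* `IsNewform0.completedLValue_ne_zero_of_ne_centre` — **every non-central critical value is non-zero**:
  `0 < n`, `2n ≠ k` ⟹ `Λ(f, n) ≠ 0`.

Consumers: edge-seed S1 of crux `KobayashiLowerHalfLargeImage` (stmt-BirchSwinnertonDyer-19001) at
`p = 3` (weight-`4` companion, `L(g, 3)`), where the Deligne binder can now be dropped; route
TangentCone / crux `EdgeCap` (stmt-BirchSwinnertonDyer-17609), reference ratios at the boundary
`2j + 2 = k`.

## References

* R. A. Rankin, *Modular forms and functions*, Cambridge Univ. Press, 1977, Thm. 4.5.2 (iii)–(iv).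
  [Rankin1977]
* R. A. Rankin, *Contributions to the theory of Ramanujan's function `τ(n)` and similar arithmetical
  functions II*, Proc. Cambridge Philos. Soc. 35 (1939), 357–372, §4. [Rankin1939]
* F. Diamond, J. Shurman, *A first course in modular forms*, GTM 228, 2005, Thm. 5.9.2, Thm. 5.10.2.
  [DiamondShurman2005]
* E. Hecke, *Über die Bestimmung Dirichletscher Reihen durch ihre Funktionalgleichung*, Math. Ann. 112
  (1936), 664–699. [Hecke1936]
-/

noncomputable section

open Complex CongruenceSubgroup UpperHalfPlane
open scoped MatrixGroups ModularForm

namespace Literature.NumberTheory.EllipticCurves.ModularForms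

variable {N : ℕ} [NeZero N] {k : ℤ}

/-- **`L(f, s) ≠ 0` on Rankin's half-plane `re s > (k+1)/2`, unconditionally**, for a newform
`f ∈ S_k(Γ₀(N))`: the coefficients satisfy `a₁ = 1` and the Hecke recursions
`a_{pn} = a_p a_n − 𝟙_{p∤N} p^{k−1} a_{n/p}` (`IsNewform0.cuspCoeff_prime_mul`), and `∑ aₙ n^{-s}` converges
absolutely there by Rankin's mean-square bound (`LSeriesSummable_cuspCoeff_of_lt_re`), so the sieve argument
`LSeries_ne_zero_of_heckeRecursion` (classically: the Euler product) applies. No Deligne bound is used.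
[cite: Rankin1977, Thm. 4.5.2 (iii)–(iv)] [cite: DiamondShurman2005, Thm. 5.9.2] -/
theorem IsNewform0.cuspFormLSeries_ne_zero_of_lt_re {f : CuspForm (Gamma0 N) k} (hf : IsNewform0 f)
    {s : ℂ} (hs : ((k : ℝ) + 1) / 2 < s.re) : cuspFormLSeries f s ≠ 0 := by
  refine HeckeRecursionLSeries.LSeries_ne_zero_of_heckeRecursion (a := cuspCoeff f) hf.2.2
    (fun p hp => ?_) (LSeriesSummable_cuspCoeff_of_lt_re (strictWidthInfty_Gamma0 N) f hs)
  refine ⟨cuspCoeff f p, if p ∣ N then 0 else (p : ℂ) ^ (k - 1), fun n _ => ?_⟩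
  rw [hf.cuspCoeff_prime_mul hp n]
  split_ifs <;> ring

/-- **`L(f, s) ≠ 0` for `re s ≥ k/2 + 1`** — Hecke's half-plane WITH its boundary (`k/2 + 1 > (k+1)/2`),
unconditionally (supersedes `IsNewform0.cuspFormLSeries_ne_zero_of_le_re_of_deligne`).
[cite: Rankin1977, Thm. 4.5.2 (iii)–(iv)] [cite: DiamondShurman2005, Thm. 5.9.2] -/
theorem IsNewform0.cuspFormLSeries_ne_zero_of_le_re {f : CuspForm (Gamma0 N) k} (hf : IsNewform0 f)
    {s : ℂ} (hs : (k : ℝ) / 2 + 1 ≤ s.re) : cuspFormLSeries f s ≠ 0 :=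
  hf.cuspFormLSeries_ne_zero_of_lt_re (by linarith)

/-- **`Λ_N(f, s) ≠ 0` for `re s > (k+1)/2` and `re s > 0`** (newform `f`; unconditional): each factor of
the raw product `N^{s/2}(2π)^{-s}Γ(s)L(f,s)` is non-zero there.
[cite: Rankin1977, Thm. 4.5.2 (iii)–(iv)] [cite: DiamondShurman2005, Thm. 5.9.2] -/
theorem IsNewform0.completedCuspFormL_ne_zero_of_lt_re {f : CuspForm (Gamma0 N) k}
    (hf : IsNewform0 f) {s : ℂ} (hs : ((k : ℝ) + 1) / 2 < s.re) (hs₀ : 0 < s.re) :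
    completedCuspFormL N f s ≠ 0 := by
  unfold completedCuspFormL
  have hN : (N : ℂ) ≠ 0 := by exact_mod_cast NeZero.ne N
  have hπ : (2 * Real.pi : ℂ) ≠ 0 := by exact_mod_cast Real.two_pi_pos.ne'
  refine mul_ne_zero (mul_ne_zero (mul_ne_zero ?_ ?_) (Complex.Gamma_ne_zero_of_re_pos hs₀))
    (hf.cuspFormLSeries_ne_zero_of_lt_re hs)
  · rw [cpow_def_of_ne_zero hN]; exact exp_ne_zero _
  · rw [cpow_def_of_ne_zero hπ]; exact exp_ne_zero _

/-- **`L(f, m) ≠ 0` at every integer `m` with `k + 1 < 2m`** (newform `f`; unconditional) — all the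
critical integers strictly right of the centre and everything beyond.
[cite: Rankin1977, Thm. 4.5.2 (iii)–(iv)] [cite: DiamondShurman2005, Thm. 5.9.2] -/
theorem IsNewform0.cuspFormLSeries_natCast_ne_zero {f : CuspForm (Gamma0 N) k} (hf : IsNewform0 f)
    {m : ℕ} (hm : k + 1 < 2 * (m : ℤ)) : cuspFormLSeries f (m : ℂ) ≠ 0 := by
  refine hf.cuspFormLSeries_ne_zero_of_lt_re ?_
  have hm' : (k : ℝ) + 1 < 2 * (m : ℝ) := by exact_mod_cast hm
  simp only [natCast_re]
  linarith

/-- **The last critical value `L(f, k − 1) ≠ 0` for a newform of weight `k ≥ 4`, unconditionally**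
(`k − 1 > (k+1)/2 ⟺ k > 3`); e.g. `L(g, p) ≠ 0` for a weight-`(p+1)` newform `g` at EVERY odd prime
`p`, including `p = 3` (weight `4`, `s = 3`, the boundary of Hecke's half-plane). Supersedes
`IsNewform0.cuspFormLSeries_edge_ne_zero_of_deligne`. [cite: Rankin1977, Thm. 4.5.2 (iii)–(iv)]
[cite: DiamondShurman2005, Thm. 5.9.2] -/
theorem IsNewform0.cuspFormLSeries_edge_ne_zero {f : CuspForm (Gamma0 N) k} (hf : IsNewform0 f)
    (hk : 4 ≤ k) : cuspFormLSeries f ((k : ℂ) - 1) ≠ 0 := by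
  refine hf.cuspFormLSeries_ne_zero_of_lt_re ?_
  have hk' : (4 : ℝ) ≤ (k : ℝ) := by exact_mod_cast hk
  simp only [sub_re, intCast_re, one_re]
  linarith

/-- **Critical values right of the centre: `Λ(f, n) = ∫₀^∞ f(it) t^{n−1} dt ≠ 0 for `0 < n`,
`k + 1 < 2n`** (newform `f`; unconditional). `Λ(f, n)` is the Mellin transform of `t ↦ f(it)` at `s = n`
(`completedLValue_eq_mellin`), Hecke's entire function `(2π)^s Γ(s)⁻¹ 𝓜(f(i·))(s)` equals `L(f, s)` on
Rankin's half-plane (`heckeContinuation_eq_cuspFormLSeries_of_lt_re`), and `L(f, n) ≠ 0` there.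
[cite: Rankin1977, Thm. 4.5.2 (iii)–(iv)] [cite: DiamondShurman2005, Thm. 5.10.2] -/
theorem IsNewform0.completedLValue_ne_zero_of_lt_two_mul {f : CuspForm (Gamma0 N) k}
    (hf : IsNewform0 f) {n : ℕ} (hn : 0 < n) (h : k + 1 < 2 * (n : ℤ)) : completedLValue f n ≠ 0 := by
  have h' : (k : ℝ) + 1 < 2 * (n : ℝ) := by exact_mod_cast h
  have hre : ((k : ℝ) + 1) / 2 < (n : ℂ).re := by
    simp only [natCast_re]
    linarith
  have hL := hf.cuspFormLSeries_ne_zero_of_lt_re hre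
  -- `hH : (2π)^n Γ(n)⁻¹ · 𝓜(f(i·))(n) = L(f, n)`
  have hH := heckeContinuation_eq_cuspFormLSeries_of_lt_re (strictWidthInfty_Gamma0 N) f hre
  rw [completedLValue_eq_mellin f hn]
  intro h0
  apply hL
  rw [← hH]
  simp only [h0, mul_zero]

/-- **Critical values left of the centre, boundary INCLUDED: `Λ(f, n) ≠ 0` for `0 < n`, `2n + 2 ≤ k`**
(newform `f ∈ S_k(Γ₀(N))`; unconditional). Proof: `N^{s/2}𝓜(f(i·))(s)` is THE entire continuation of
`Λ_N(f, s)` (`cpow_mul_mellin_imagAxis_mem_completedCuspFormLContinuations`,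
`subsingleton_completedCuspFormLContinuations`); Hecke's functional equation `Λ(n) = i^k ε(f) Λ(k−n)`
with `ε(f) = ±1` (`IsNewform0.exists_functional_equation_holds`,
`IsNewform0.frickeEigenvalue_eq_one_or_eq_neg_one_holds`); the continuation agrees with the raw product
on Rankin's half-plane (`eq_completedCuspFormL_of_mem_continuations_of_lt_re`), which contains
`k − n ≥ k/2 + 1 > (k+1)/2`; and `Λ_N(f, k − n) ≠ 0` there (`IsNewform0.completedCuspFormL_ne_zero_of_lt_re`).
The case `2n + 2 < k` is `IsNewform0.completedLValue_ne_zero_of_two_mul_add_two_lt`; the boundary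
`2n + 2 = k` was flagged there as needing Deligne's bound — Rankin's mean square suffices.
[cite: Rankin1977, Thm. 4.5.2 (iii)–(iv)] [cite: DiamondShurman2005, Thm. 5.10.2] -/
theorem IsNewform0.completedLValue_ne_zero_of_two_mul_add_two_le {f : CuspForm (Gamma0 N) k}
    (hf : IsNewform0 f) {n : ℕ} (hn : 0 < n) (h : 2 * (n : ℤ) + 2 ≤ k) :
    completedLValue f n ≠ 0 := by
  have hk : -2 ≤ k := by omega
  have hΛ := cpow_mul_mellin_imagAxis_mem_completedCuspFormLContinuations hk (strictWidthInfty_Gamma0 N) N f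
  obtain ⟨Λ', hΛ', hFE⟩ := IsNewform0.exists_functional_equation_holds (N := N) (k := k) hf
  have heq := subsingleton_completedCuspFormLContinuations N f hΛ' hΛ
  have hε : frickeEigenvalue f = 1 ∨ frickeEigenvalue f = -1 :=
    IsNewform0.frickeEigenvalue_eq_one_or_eq_neg_one_holds (N := N) (k := k) hf
  -- the reflected point `k − n` lies in Rankin's half-plane (and right of `0`)
  have h' : 2 * (n : ℝ) + 2 ≤ (k : ℝ) := by exact_mod_cast h
  have hre : ((k : ℝ) + 1) / 2 < ((k : ℂ) - (n : ℂ)).re := by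
    simp only [sub_re, intCast_re, natCast_re]
    linarith
  have hre₀ : 0 < ((k : ℂ) - (n : ℂ)).re := by
    have hn' : (0 : ℝ) ≤ n := by positivity
    simp only [sub_re, intCast_re, natCast_re]
    linarith
  have hval := eq_completedCuspFormL_of_mem_continuations_of_lt_re hΛ hre hre₀
  have hne : completedCuspFormL N f ((k : ℂ) - (n : ℂ)) ≠ 0 :=
    hf.completedCuspFormL_ne_zero_of_lt_re hre hre₀
  -- functional equation at `s = n`, for THE continuation
  have h1 := hFE (n : ℂ)
  rw [heq] at h1
  simp only [] at h1 hval
  rw [hval] at h1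
  have hΛn : (N : ℂ) ^ ((n : ℂ) / 2) *
      mellin (fun t : ℝ ↦ (f : UpperHalfPlane → ℂ) (UpperHalfPlane.ofComplex (Complex.I * (t : ℂ))))
        (n : ℂ) ≠ 0 := by
    rw [h1]
    refine mul_ne_zero (mul_ne_zero (zpow_ne_zero _ I_ne_zero) ?_) hne
    rcases hε with h' | h' <;> simp [h']
  rw [completedLValue_eq_mellin f hn]
  exact fun h0 => hΛn (by rw [h0, mul_zero])

/-- **Every non-central critical value of a newform is non-zero** (unconditional): for
`f ∈ S_k(Γ₀(N))` a newform and a positive integer `n` with `2n ≠ k` (so every critical `1 ≤ n ≤ k − 1`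
off the centre, and every integer `n ≥ k` as well), `Λ(f, n) = ∫₀^∞ f(it) t^{n−1} dt ≠ 0`. Right of the
centre by absolute convergence on Rankin's half-plane, left of it by Hecke's functional equation; the
weight is even because `-1 ∈ Γ₀(N)`. (The central value `n = k/2` may vanish.)
[cite: Rankin1977, Thm. 4.5.2 (iii)–(iv)] [cite: DiamondShurman2005, Thm. 5.10.2] -/
theorem IsNewform0.completedLValue_ne_zero_of_ne_centre {f : CuspForm (Gamma0 N) k}
    (hf : IsNewform0 f) {n : ℕ} (hn : 0 < n) (hc : 2 * (n : ℤ) ≠ k) :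
    completedLValue f n ≠ 0 := by
  -- the weight is even: `-1 ∈ Γ₀(N)` kills odd weight (`eq_zero_of_odd_weight_gamma0`), while `a₁(f) = 1`
  have heven : ¬ Odd k := by
    intro hodd
    have h0 : f = 0 := eq_zero_of_odd_weight_gamma0 N hodd f
    have h1 : (qExpansion 1 ⇑f).coeff 1 = 1 := hf.2.2
    rw [h0, CuspForm.coe_zero, qExpansion_zero, map_zero] at h1
    exact zero_ne_one h1
  rw [← Int.not_even_iff_odd, not_not] at heven
  obtain ⟨j, hj⟩ := heven
  rcases lt_or_gt_of_ne hc with hlt | hgt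
  · -- left of the centre
    exact hf.completedLValue_ne_zero_of_two_mul_add_two_le hn (by omega)
  · -- right of the centre
    exact hf.completedLValue_ne_zero_of_lt_two_mul hn (by omega)

end Literature.NumberTheory.EllipticCurves.ModularForms

end
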